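import Literature.NumberTheory.LFunctions.DirichletLFunctionEulerProductMeanSquare
import HarnessLib

/-!
# Finite Euler products approximate `L(s, χ)` in mean square — every `χ`, with shifts

Topic `Literature/NumberTheory/LFunctions` (namespace `Literature.NumberTheory.LFunctions`,
grouping sub-namespace `CharEulerProductMeanSquare`). Everything in this file is PROVED. It puts
the mean-square approximation of Dirichlet `L`-functions by finite Euler products into the exact
shape of the tree's fact `zeta_sub_finiteEulerProduct_meanSquare_uniform` for `ζ` (integration
from `0`, imaginary shifts `|a| ≤ A`, `σ` in a compact part of `(1/2, 1)`), for EVERY Dirichlet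
character `χ` mod `q`:

* `CharEulerProductMeanSquare.LFunction_sub_finiteEulerProduct_meanSquare_uniform` — for
  `1/2 < σ₁ ≤ σ₂ < 1`, `A ≥ 0`, `ε > 0` there is `P₀` such that for all `P ≥ P₀` there is `T₀`
  with `∫₀ᵀ |L(σ + i(t+a), χ) − ∏_{p<P} (1 − χ(p) p^{−(σ + i(t+a))})⁻¹|² dt ≤ ε T` for all
  `T ≥ T₀`, `σ₁ ≤ σ ≤ σ₂`, `|a| ≤ A`.

Non-principal `χ`: the `[−T, T]` estimate of `DirichletLFunctionEulerProductMeanSquare.lean`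
(`LFunction_sub_finiteEulerProduct_meanSquare_le_uniform`) after the substitution `u = t + a`
(`LFunction_sub_finiteEulerProduct_meanSquare_shift`). Principal `χ = χ₀` mod `q`: for `P > q`,
`L(s, χ₀) − ∏_{p<P}(1 − χ₀(p)p^{−s})⁻¹ = (∏_{p∣q}(1 − p^{−s}))(ζ(s) − ∏_{p<P}(1 − p^{−s})⁻¹)`
(Mathlib's `DirichletCharacter.LFunctionTrivChar_eq_mul_riemannZeta` and `eulerProduct_one_eq`),
`‖∏_{p∣q}(1 − p^{−s})‖ ≤ 2^{ω(q)}`, and the tree's PROVED fact for `ζ`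
(`zeta_sub_finiteEulerProduct_meanSquare_uniform_holds`). This is the mean-square input
(property (4) of the class `E`, and `S₂` in the proof of Lemma 3.1) of Pańkowski's hybrid joint
universality theorem, for the inline discharge of `Pankowski2010_thm1_1_discAnalytic`.

## References

* [Titchmarsh1986] E. C. Titchmarsh, *The Theory of the Riemann Zeta-Function*, 2nd ed., §11.9
  (first display).
* [Pankowski2010] Ł. Pańkowski, *Hybrid joint universality theorem for Dirichlet L-functions*,
  Acta Arith. 141 (2010), 59–72, §2 (class `E`, (4)) and Lemma 3.1 (proof, `S₂`).
-/

noncomputable section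

open Complex Filter Topology MeasureTheory Set

namespace Literature.NumberTheory.LFunctions

namespace CharEulerProductMeanSquare

open EulerProductMeanSquare

variable {q : ℕ} [NeZero q] (χ : DirichletCharacter ℂ q)

/-! ### Non-principal characters: integration from `0` with shifts -/

/-- Non-principal `χ`: for `1/2 < σ₁ ≤ σ₂`, `A ≥ 0`, `ε > 0` there is `P₀` such that for all
`P ≥ P₀` there is `T₀` with `∫₀ᵀ |L(σ + i(t+a), χ) − ∏_{p<P}(1 − χ(p)p^{−σ−i(t+a)})⁻¹|² dt ≤ ε T`
for `T ≥ T₀`, `σ ∈ [σ₁, σ₂]`, `|a| ≤ A` (substitute `u = t + a` in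
`LFunction_sub_finiteEulerProduct_meanSquare_le_uniform` on `[−(T+A), T+A]`).
[cite: Titchmarsh1986, §11.9 (first display)] -/
theorem LFunction_sub_finiteEulerProduct_meanSquare_shift (hχ : χ ≠ 1) {σ₁ σ₂ A ε : ℝ}
    (hσ₁ : 1 / 2 < σ₁) (hσ₁₂ : σ₁ ≤ σ₂) (hA : 0 ≤ A) (hε : 0 < ε) :
    ∃ P₀ : ℕ, ∀ P : ℕ, P₀ ≤ P → ∃ T₀ : ℝ, ∀ T : ℝ, T₀ ≤ T →
      ∀ σ : ℝ, σ₁ ≤ σ → σ ≤ σ₂ → ∀ a : ℝ, |a| ≤ A →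
        ∫ t in (0 : ℝ)..T, ‖χ.LFunction (σ + (t + a) * I) -
            ∏ p ∈ P.primesBelow, (1 - χ p * (p : ℂ) ^ (-(σ + (t + a) * I : ℂ)))⁻¹‖ ^ 2 ≤ ε * T := by
  have hσ₁0 : 0 < σ₁ := by linarith
  obtain ⟨P₀, hP₀⟩ := LFunction_sub_finiteEulerProduct_meanSquare_le_uniform χ hχ hσ₁ hσ₁₂
    (half_pos hε)
  refine ⟨P₀, fun P hP ↦ ?_⟩
  obtain ⟨T₀, hT₀⟩ := hP₀ P hP
  refine ⟨max T₀ A, fun T hT σ hσa hσb a ha ↦ ?_⟩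
  have hT₀' : T₀ ≤ T := (le_max_left _ _).trans hT
  have hTA : A ≤ T := (le_max_right _ _).trans hT
  obtain ⟨ha1, ha2⟩ := abs_le.1 ha
  have hσ0 : 0 < σ := by linarith
  set F : ℝ → ℝ := fun u ↦ ‖χ.LFunction (σ + u * I) -
    ∏ p ∈ P.primesBelow, (1 - χ p * (p : ℂ) ^ (-(σ + u * I : ℂ)))⁻¹‖ ^ 2 with hF
  have hFc : Continuous F :=
    (continuous_norm.comp (continuous_LFunction_sub_eulerProduct χ hχ hσ0 P)).pow 2
  have hF0 : ∀ u, 0 ≤ F u := fun u ↦ by rw [hF]; positivity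
  have hFi : ∀ x y : ℝ, IntervalIntegrable F volume x y := fun x y ↦ hFc.intervalIntegrable _ _
  -- substitute `u = t + a`
  have hsub : ∫ t in (0 : ℝ)..T, ‖χ.LFunction (σ + (t + a) * I) -
      ∏ p ∈ P.primesBelow, (1 - χ p * (p : ℂ) ^ (-(σ + (t + a) * I : ℂ)))⁻¹‖ ^ 2 =
      ∫ u in a..T + a, F u := by
    have h := intervalIntegral.integral_comp_add_right F a (a := 0) (b := T)
    rw [zero_add] at h
    rw [← h]
    refine intervalIntegral.integral_congr fun t _ ↦ ?_
    simp only [hF]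
    push_cast
    ring_nf
  rw [hsub]
  have hmono : ∫ u in a..T + a, F u ≤ ∫ u in (-(T + A))..(T + A), F u :=
    intervalIntegral.integral_mono_interval (by linarith) (by linarith) (by linarith)
      (Filter.Eventually.of_forall hF0) (hFi _ _)
  have hmain := hT₀ (T + A) (by linarith) σ hσa hσb
  have hmain' : ∫ u in (-(T + A))..(T + A), F u ≤ ε / 2 * (T + A) := by
    simpa only [hF] using hmain
  calc ∫ u in a..T + a, F u ≤ ε / 2 * (T + A) := hmono.trans hmain'
    _ ≤ ε * T := by nlinarith

/-! ### Continuity along vertical lines in the strip, any character -/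

/-- For any `χ` mod `q`, `0 < σ < 1` and real `a`, the shifted integrand
`t ↦ L(σ + i(t+a), χ) − ∏_{p<P}(1 − χ(p)p^{−σ−i(t+a)})⁻¹` is continuous (the only possible
pole `s = 1` has `Re s = 1`). [folklore] -/
theorem continuous_LFunction_sub_eulerProduct_shift {σ : ℝ} (hσ0 : 0 < σ) (hσ1 : σ < 1)
    (P : ℕ) (a : ℝ) :
    Continuous fun t : ℝ ↦ χ.LFunction (σ + (t + a) * I) -
      ∏ p ∈ P.primesBelow, (1 - χ p * (p : ℂ) ^ (-(σ + (t + a) * I : ℂ)))⁻¹ := by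
  have hmap : Continuous fun t : ℝ ↦ (σ : ℂ) + (t + a) * I := by fun_prop
  have hne : ∀ t : ℝ, (σ : ℂ) + (t + a) * I ≠ 1 := by
    intro t h
    have := congrArg Complex.re h
    simp at this
    linarith
  refine Continuous.sub ?_ ?_
  · rw [continuous_iff_continuousAt]
    intro t
    exact ContinuousAt.comp (f := fun t : ℝ ↦ (σ : ℂ) + (t + a) * I)
      ((DirichletCharacter.differentiableAt_LFunction χ _ (Or.inl (hne t))).continuousAt)
      hmap.continuousAt
  · refine continuous_finsetProd _ fun p hp ↦ ?_
    have hpp : p.Prime := Nat.prime_of_mem_primesBelow hp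
    have hp0 : (p : ℂ) ≠ 0 := by exact_mod_cast hpp.ne_zero
    have hc : Continuous fun t : ℝ ↦ (1 : ℂ) - χ p * (p : ℂ) ^ (-(σ + (t + a) * I : ℂ)) :=
      continuous_const.sub (continuous_const.mul ((hmap.neg).const_cpow (Or.inl hp0)))
    refine hc.inv₀ fun t h ↦ ?_
    have hlt : ‖χ p * (p : ℂ) ^ (-(σ + (t + a) * I : ℂ))‖ < 1 :=
      (norm_char_mul_cpow_le χ hpp.pos _).trans_lt
        (rpow_neg_re_lt_one hpp (show 0 < ((σ : ℂ) + (t + a) * I).re by simp [hσ0]))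
    rw [sub_eq_zero] at h
    rw [← h, norm_one] at hlt
    exact lt_irrefl _ hlt

/-! ### The principal character: reduction to `ζ` -/

/-- For `P > q` the twisted finite Euler product of the principal character mod `q` is
`(∏_{p ∣ q} (1 − p^{−s})) · ∏_{p<P} (1 − p^{−s})⁻¹` (`Re s > 0`). [folklore] -/
theorem eulerProduct_one_eq {P : ℕ} (hPq : q < P) {s : ℂ} (hs : 0 < s.re) :
    ∏ p ∈ P.primesBelow, (1 - (1 : DirichletCharacter ℂ q) p * (p : ℂ) ^ (-s))⁻¹ =
      (∏ p ∈ q.primeFactors, (1 - (p : ℂ) ^ (-s))) *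
        ∏ p ∈ P.primesBelow, (1 - (p : ℂ) ^ (-s))⁻¹ := by
  classical
  have hq0 : q ≠ 0 := NeZero.ne q
  -- split both products at `p ∣ q`
  have hfilt : (P.primesBelow).filter (fun p ↦ p ∣ q) = q.primeFactors := by
    ext p
    simp only [Finset.mem_filter, Nat.mem_primesBelow, Nat.mem_primeFactors]
    constructor
    · rintro ⟨⟨-, hp⟩, hdvd⟩; exact ⟨hp, hdvd, hq0⟩
    · rintro ⟨hp, hdvd, -⟩
      exact ⟨⟨lt_of_le_of_lt (Nat.le_of_dvd (Nat.pos_of_ne_zero hq0) hdvd) hPq, hp⟩, hdvd⟩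
  rw [← Finset.prod_filter_mul_prod_filter_not (P.primesBelow) (fun p ↦ p ∣ q),
    ← Finset.prod_filter_mul_prod_filter_not (P.primesBelow) (fun p ↦ p ∣ q)
      (f := fun p ↦ (1 - (p : ℂ) ^ (-s))⁻¹), hfilt]
  -- on `p ∣ q` the character vanishes; on `p ∤ q` it is `1`
  have h1 : ∏ p ∈ q.primeFactors, (1 - (1 : DirichletCharacter ℂ q) p * (p : ℂ) ^ (-s))⁻¹ = 1 := by
    refine Finset.prod_eq_one fun p hp ↦ ?_
    have hpp := (Nat.mem_primeFactors.1 hp).1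
    have hdvd := (Nat.mem_primeFactors.1 hp).2.1
    have hnu : ¬ IsUnit (p : ZMod q) := fun h ↦ ((ZMod.isUnit_prime_iff_not_dvd hpp).1 h) hdvd
    rw [MulChar.map_nonunit _ hnu, zero_mul, sub_zero, inv_one]
  have h2 : ∏ p ∈ (P.primesBelow).filter (fun p ↦ ¬ p ∣ q),
      (1 - (1 : DirichletCharacter ℂ q) p * (p : ℂ) ^ (-s))⁻¹ =
      ∏ p ∈ (P.primesBelow).filter (fun p ↦ ¬ p ∣ q), (1 - (p : ℂ) ^ (-s))⁻¹ := by
    refine Finset.prod_congr rfl fun p hp ↦ ?_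
    have hpp := Nat.prime_of_mem_primesBelow (Finset.mem_filter.1 hp).1
    have hndvd := (Finset.mem_filter.1 hp).2
    have hu : IsUnit (p : ZMod q) := (ZMod.isUnit_prime_iff_not_dvd hpp).2 hndvd
    rw [MulChar.one_apply hu, one_mul]
  have h3 : (∏ p ∈ q.primeFactors, (1 - (p : ℂ) ^ (-s))) *
      ∏ p ∈ q.primeFactors, (1 - (p : ℂ) ^ (-s))⁻¹ = 1 := by
    rw [← Finset.prod_mul_distrib]
    refine Finset.prod_eq_one fun p hp ↦ mul_inv_cancel₀ ?_
    exact one_sub_prime_cpow_ne_zero (Nat.mem_primeFactors.1 hp).1 hs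
  rw [h1, h2, one_mul, ← mul_assoc, h3, one_mul]

omit [NeZero q] in
/-- `‖∏_{p ∣ q} (1 − p^{−s})‖ ≤ 2^{ω(q)}` for `Re s > 0`. [folklore] -/
theorem norm_prod_primeFactors_le {s : ℂ} (hs : 0 < s.re) :
    ‖∏ p ∈ q.primeFactors, (1 - (p : ℂ) ^ (-s))‖ ≤ 2 ^ q.primeFactors.card := by
  rw [norm_prod]
  calc ∏ p ∈ q.primeFactors, ‖1 - (p : ℂ) ^ (-s)‖ ≤ ∏ _p ∈ q.primeFactors, (2 : ℝ) := by
        refine Finset.prod_le_prod (fun _ _ ↦ norm_nonneg _) fun p hp ↦ ?_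
        have hpp := (Nat.mem_primeFactors.1 hp).1
        calc ‖1 - (p : ℂ) ^ (-s)‖ ≤ ‖(1 : ℂ)‖ + ‖(p : ℂ) ^ (-s)‖ := norm_sub_le _ _
          _ ≤ 1 + 1 := by
              rw [norm_one]; gcongr; exact (norm_prime_cpow_neg_lt_one hpp hs).le
          _ = 2 := by norm_num
    _ = 2 ^ q.primeFactors.card := Finset.prod_const _

/-- Principal `χ = χ₀` mod `q`: the mean-square approximation by finite Euler products, with
shifts, from the tree's fact for `ζ` (`zeta_sub_finiteEulerProduct_meanSquare_uniform_holds`):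
`L(s, χ₀) − ∏_{p<P}(1 − χ₀(p)p^{−s})⁻¹ = (∏_{p∣q}(1 − p^{−s})) (ζ(s) − ∏_{p<P}(1 − p^{−s})⁻¹)`
for `P > q`. [cite: Titchmarsh1986, §11.9 (first display)] -/
theorem LFunction_one_sub_finiteEulerProduct_meanSquare_shift {σ₁ σ₂ A ε : ℝ}
    (hσ₁ : 1 / 2 < σ₁) (hσ₁₂ : σ₁ ≤ σ₂) (hσ₂ : σ₂ < 1) (hA : 0 ≤ A) (hε : 0 < ε) :
    ∃ P₀ : ℕ, ∀ P : ℕ, P₀ ≤ P → ∃ T₀ : ℝ, ∀ T : ℝ, T₀ ≤ T →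
      ∀ σ : ℝ, σ₁ ≤ σ → σ ≤ σ₂ → ∀ a : ℝ, |a| ≤ A →
        ∫ t in (0 : ℝ)..T, ‖(1 : DirichletCharacter ℂ q).LFunction (σ + (t + a) * I) -
            ∏ p ∈ P.primesBelow, (1 - (1 : DirichletCharacter ℂ q) p *
              (p : ℂ) ^ (-(σ + (t + a) * I : ℂ)))⁻¹‖ ^ 2 ≤ ε * T := by
  set W : ℝ := (2 : ℝ) ^ q.primeFactors.card with hW
  have hW0 : 0 < W := by positivity
  obtain ⟨P₀, hP₀⟩ := zeta_sub_finiteEulerProduct_meanSquare_uniform_holds σ₁ σ₂ A (ε / W ^ 2)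
    hσ₁ hσ₁₂ hσ₂ hA (by positivity)
  refine ⟨max P₀ (q + 1), fun P hP ↦ ?_⟩
  have hPP₀ : P₀ ≤ P := (le_max_left _ _).trans hP
  have hPq : q < P := lt_of_lt_of_le (Nat.lt_succ_self q) ((le_max_right _ _).trans hP)
  obtain ⟨T₀, hT₀⟩ := hP₀ P hPP₀
  refine ⟨max T₀ 0, fun T hT σ hσa hσb a ha ↦ ?_⟩
  have hT' : T₀ ≤ T := (le_max_left _ _).trans hT
  have hT0 : 0 ≤ T := (le_max_right _ _).trans hT
  have hmain := hT₀ T hT' σ hσa hσb a ha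
  have hσ0 : 0 < σ := by linarith
  have hσ1 : σ < 1 := lt_of_le_of_lt hσb hσ₂
  -- pointwise identity and bound
  have hpt : ∀ t : ℝ, ‖(1 : DirichletCharacter ℂ q).LFunction (σ + (t + a) * I) -
      ∏ p ∈ P.primesBelow, (1 - (1 : DirichletCharacter ℂ q) p *
        (p : ℂ) ^ (-(σ + (t + a) * I : ℂ)))⁻¹‖ ^ 2 ≤
      W ^ 2 * ‖riemannZeta (σ + (t + a) * I) -
        ∏ p ∈ P.primesBelow, (1 - (p : ℂ) ^ (-(σ + (t + a) * I : ℂ)))⁻¹‖ ^ 2 := by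
    intro t
    set s : ℂ := σ + (t + a) * I with hs_def
    have hs : 0 < s.re := by simp [hs_def, hσ0]
    have hs1 : s ≠ 1 := by
      intro h
      have := congrArg Complex.re h
      simp [hs_def] at this
      linarith
    have hL : (1 : DirichletCharacter ℂ q).LFunction s =
        (∏ p ∈ q.primeFactors, (1 - (p : ℂ) ^ (-s))) * riemannZeta s :=
      DirichletCharacter.LFunctionTrivChar_eq_mul_riemannZeta hs1
    rw [hL, eulerProduct_one_eq hPq hs, ← mul_sub, norm_mul, mul_pow]
    refine mul_le_mul_of_nonneg_right ?_ (by positivity)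
    exact pow_le_pow_left₀ (norm_nonneg _) (norm_prod_primeFactors_le hs) 2
  -- integrate
  have hcontζ : Continuous fun t : ℝ ↦ ‖riemannZeta (σ + (t + a) * I) -
      ∏ p ∈ P.primesBelow, (1 - (p : ℂ) ^ (-(σ + (t + a) * I : ℂ)))⁻¹‖ ^ 2 := by
    have h := EulerProductMeanSquareUniform.continuous_zeta_sub_eulerProduct_line hσ0 hσ1 P
    have e : (fun t : ℝ ↦ ‖riemannZeta (σ + (t + a) * I) -
        ∏ p ∈ P.primesBelow, (1 - (p : ℂ) ^ (-(σ + (t + a) * I : ℂ)))⁻¹‖ ^ 2) =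
        (fun u : ℝ ↦ ‖riemannZeta (σ + u * I) -
          ∏ p ∈ P.primesBelow, (1 - (p : ℂ) ^ (-(σ + u * I : ℂ)))⁻¹‖ ^ 2) ∘ fun t ↦ t + a := by
      funext t; simp only [Function.comp_apply]; push_cast; ring_nf
    rw [e]; exact h.comp (continuous_add_const a)
  have hcontL : Continuous fun t : ℝ ↦ ‖(1 : DirichletCharacter ℂ q).LFunction (σ + (t + a) * I) -
      ∏ p ∈ P.primesBelow, (1 - (1 : DirichletCharacter ℂ q) p *
        (p : ℂ) ^ (-(σ + (t + a) * I : ℂ)))⁻¹‖ ^ 2 :=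
    (continuous_norm.comp (continuous_LFunction_sub_eulerProduct_shift 1 hσ0 hσ1 P a)).pow 2
  calc ∫ t in (0 : ℝ)..T, ‖(1 : DirichletCharacter ℂ q).LFunction (σ + (t + a) * I) -
        ∏ p ∈ P.primesBelow, (1 - (1 : DirichletCharacter ℂ q) p *
          (p : ℂ) ^ (-(σ + (t + a) * I : ℂ)))⁻¹‖ ^ 2
      ≤ ∫ t in (0 : ℝ)..T, W ^ 2 * ‖riemannZeta (σ + (t + a) * I) -
          ∏ p ∈ P.primesBelow, (1 - (p : ℂ) ^ (-(σ + (t + a) * I : ℂ)))⁻¹‖ ^ 2 :=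
        intervalIntegral.integral_mono_on hT0 (hcontL.intervalIntegrable _ _)
          ((hcontζ.const_mul _).intervalIntegrable _ _) fun t _ ↦ hpt t
    _ = W ^ 2 * ∫ t in (0 : ℝ)..T, ‖riemannZeta (σ + (t + a) * I) -
          ∏ p ∈ P.primesBelow, (1 - (p : ℂ) ^ (-(σ + (t + a) * I : ℂ)))⁻¹‖ ^ 2 :=
        intervalIntegral.integral_const_mul _ _
    _ ≤ W ^ 2 * (ε / W ^ 2 * T) := mul_le_mul_of_nonneg_left hmain (by positivity)
    _ = ε * T := by field_simp

/-! ### Every character -/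

/-- **Finite Euler products approximate `L(s, χ)` in mean square, locally uniformly in
`1/2 < σ < 1`, with bounded imaginary shifts — every Dirichlet character `χ`.** For
`1/2 < σ₁ ≤ σ₂ < 1`, `A ≥ 0`, `ε > 0` there is `P₀` such that for all `P ≥ P₀` there is `T₀` with
`∫₀ᵀ |L(σ + i(t+a), χ) − ∏_{p<P, p prime} (1 − χ(p) p^{−(σ + i(t+a))})⁻¹|² dt ≤ ε T`
for all `T ≥ T₀`, `σ₁ ≤ σ ≤ σ₂` and `|a| ≤ A` (the exact shape of the tree's fact
`zeta_sub_finiteEulerProduct_meanSquare_uniform` for `ζ`). Non-principal `χ`: iterated Abel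
summation + the mean value theorem for Dirichlet polynomials
(`LFunction_sub_finiteEulerProduct_meanSquare_le_uniform`); principal `χ`: reduction to `ζ`.
This is the mean-square input ("property (4) of the class `E`" and the estimate of `S₂` in the
proof of Lemma 3.1, "arguing analogously to [KV, Ch. VII]") of Pańkowski's hybrid joint
universality theorem. [cite: Titchmarsh1986, §11.9 (first display)]
[cite: Pankowski2010, §2 (class E, (4)) and Lemma 3.1 (proof, S₂)] -/
theorem LFunction_sub_finiteEulerProduct_meanSquare_uniform (σ₁ σ₂ A ε : ℝ)
    (hσ₁ : 1 / 2 < σ₁) (hσ₁₂ : σ₁ ≤ σ₂) (hσ₂ : σ₂ < 1) (hA : 0 ≤ A) (hε : 0 < ε) :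
    ∃ P₀ : ℕ, ∀ P : ℕ, P₀ ≤ P → ∃ T₀ : ℝ, ∀ T : ℝ, T₀ ≤ T →
      ∀ σ : ℝ, σ₁ ≤ σ → σ ≤ σ₂ → ∀ a : ℝ, |a| ≤ A →
        ∫ t in (0 : ℝ)..T, ‖χ.LFunction (σ + (t + a) * I) -
            ∏ p ∈ P.primesBelow, (1 - χ p * (p : ℂ) ^ (-(σ + (t + a) * I : ℂ)))⁻¹‖ ^ 2 ≤ ε * T := by
  by_cases hχ : χ = 1
  · subst hχ
    exact LFunction_one_sub_finiteEulerProduct_meanSquare_shift hσ₁ hσ₁₂ hσ₂ hA hε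
  · exact LFunction_sub_finiteEulerProduct_meanSquare_shift χ hχ hσ₁ hσ₁₂ hA hε

end CharEulerProductMeanSquare

end Literature.NumberTheory.LFunctions
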